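import Literature.LinearAlgebra.Matrix.IntegralUnitaryConjugacyOfRegularElements
import Literature.NumberTheory.QuadraticForms.HermitianUnimodularLocalRing
import Mathlib.RingTheory.LocalRing.Module
import Mathlib.LinearAlgebra.Matrix.Basis
import Mathlib.LinearAlgebra.Matrix.Block
import HarnessLib

/-!
# Self-adjoint idempotents over a local ring with involution: the adapted ORTHONORMAL frame, and norm surjectivity on the
# commutant (Kottwitz, *Stable trace formula: elliptic singular terms* (1986), Prop. 7.1 for `U(J)` at a SINGULAR semisimple
# element; Jacobowitz, *Hermitian forms over local fields* (1962), Thm. 7.1)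

Topic `LinearAlgebra/Matrix`; namespace `Literature.LinearAlgebra.Matrix`; THEOREMS ONLY (no definition, no instance, no named fact,
no `sorry`), Mathlib + ★ `IntegralUnitaryConjugacyOfRegularElements` (§1 there: the adjoint `τ X = J⁻¹ ᵗ(σX) J`, spelled out here
too) + ★ `QuadraticForms/HermitianUnimodularLocalRing` (Jacobowitz: unimodular `σ`-hermitian matrices over a local ring with
involution satisfying (trace) `∃ t, t + σ t = 1` and (norm) `σ u = u ∈ 𝒪ˣ ⇒ u = s σ(s)` are congruent to `1`).

WHY.  Kottwitz's orbit lemma `{y ∣ y γ y⁻¹ ∈ K} = K · Z(γ)` for the hyperspecial `K = U(J)(𝒪)` is in the tree at REGULAR semisimple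
`γ` (★ `IntegralConjugacyOfRegularElements` → ★ `IntegralUnitaryConjugacyOfRegularElements` → ★ `IntegralUnitaryConjugacyComplete`:
the commutant `𝒪[γ]` is a commutative étale order and the unitary upgrade is a NORM EQUATION there).  At a SINGULAR semisimple `γ`
— for `U(3)`, eigenvalues `(a, a, b)` — the commutant is `M_r(𝒪) × M_{m−r}(𝒪)`, non-commutative, and the norm equation `τ(c) c = b`
on it is the CONGRUENCE of unimodular hermitian BLOCKS; ★ `exists_integral_unitary_conj_of_conj` already states its hypothesis
`hnorm` on the commutant without commutativity, so all that is needed is `hnorm` for the commutant of a `τ`-self-adjoint idempotent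
`e` (the Lagrange idempotent of `γ`).  This file proves it from Jacobowitz's theorem:

* §1 `exists_congr_one_of_offBlock_eq_zero` — Jacobowitz's orthonormal basis BLOCK BY BLOCK: a unimodular hermitian `G` vanishing
  off the two diagonal blocks of a predicate `p` is congruent to `1` by a `T` with the same block structure (★
  `HermitianUnimodular.exists_formCongr_eq_one` twice, reassembled along `Equiv.sumCompl p`).
* §2 **`exists_formUnitary_frame_of_isIdempotentElem`** — the ADAPTED ORTHONORMAL FRAME: for `e² = e`, `τ e = e` there is
  `B ∈ GL_m(𝒪)` with `ᵗ(σB) J B = 1` and `e B = B · diag(𝟙_{i < r})`, `r = rank_𝒪 (range e)` (range ∕ kernel of `e` are complementary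
  direct summands of `𝒪^m`, finite projective hence FREE over the local ring — Mathlib `Module.free_of_flat_of_isLocalRing` —,
  `J`-orthogonal since `τ e = e`; the Gram matrix of an adapted basis is unimodular and commutes with `diag(𝟙_{i<r})`; §1).
* §3 **`exists_commute_hermAdjoint_mul_eq_of_isIdempotentElem`** — `hnorm` for `e`: every `τ`-fixed invertible `b` commuting with
  `e` is `τ(c) c` with `c` commuting with `e` (`c = B B′⁻¹` for the frames of `e` w.r.t. `J` and `J b`).

The split semisimple ∕ orbit consequences (Kottwitz's lemma at `γ` with `(γ − a)(γ − b) = 0`) are the sequel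
`IntegralUnitaryConjugacyOfIdempotents`; the `GL_m` conjugator itself is `IntegralConjugacyOfIdempotents` (A-p01); the places ∕ a.e.
dress over a CM field is under `NumberTheory/`.

## References
* R. E. Kottwitz, *Stable trace formula: elliptic singular terms*, Math. Ann. 275 (1986), §7 Prop. 7.1, Cor. 7.3 [Kottwitz1986].
* R. Jacobowitz, *Hermitian forms over local fields*, Amer. J. Math. 84 (1962), §4, §7 Thm. 7.1 [Jacobowitz1962].
* J. D. Rogawski, *Automorphic Representations of Unitary Groups in Three Variables*, Ann. of Math. Stud. 123 (1990), §3.3 p. 21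
  [Rogawski1990].
-/

set_option autoImplicit false

open Matrix

namespace Literature.LinearAlgebra.Matrix

open Literature.NumberTheory.Automorphic (formCongr)
open Literature.NumberTheory.QuadraticForms

/-! ## §1 Block-diagonal congruence: Jacobowitz's normal form respecting a splitting of the index set -/

section Block

variable {𝒪 : Type*} [CommRing 𝒪] [IsLocalRing 𝒪] (σ : 𝒪 →+* 𝒪)

/-- **Jacobowitz's orthonormal basis, block by block.**  Over a local ring with involution satisfying (trace) and (norm), a
unimodular `σ`-hermitian matrix `G` whose entries vanish off the two diagonal blocks cut out by a predicate `p` on the index set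
(`G i j = 0` unless `p i ↔ p j`) is congruent to `1` by a matrix with the SAME block structure: `ᵗ(σT) G T = 1`, `T i j = 0` unless
`p i ↔ p j` (★ `HermitianUnimodular.exists_formCongr_eq_one` on each of the two diagonal blocks, reassembled along
`Equiv.sumCompl p`). [cite: Jacobowitz1962, §7 Thm. 7.1] -/
theorem exists_congr_one_of_offBlock_eq_zero (hσ : ∀ x, σ (σ x) = x) (htr : ∃ b : 𝒪, b + σ b = 1)
    (hnorm : ∀ u : 𝒪, IsUnit u → σ u = u → ∃ t : 𝒪, t * σ t = u)
    {ι : Type*} [Fintype ι] [DecidableEq ι] (p : ι → Prop) [DecidablePred p]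
    (G : Matrix ι ι 𝒪) (hG : (G.map σ)ᵀ = G) (hdet : IsUnit G.det) (hoff : ∀ i j, ¬ (p i ↔ p j) → G i j = 0) :
    ∃ T : Matrix ι ι 𝒪, IsUnit T.det ∧ (T.map σ)ᵀ * G * T = 1 ∧ ∀ i j, ¬ (p i ↔ p j) → T i j = 0 := by
  classical
  -- the two diagonal blocks are hermitian and unimodular
  have hG₁ : ((G.toBlock p p).map σ)ᵀ = G.toBlock p p := by
    ext a b
    have h := congr_fun (congr_fun hG a) b
    simpa [Matrix.toBlock, Matrix.transpose_apply, Matrix.map_apply] using h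
  have hG₂ : ((G.toBlock (fun i => ¬ p i) (fun i => ¬ p i)).map σ)ᵀ = G.toBlock (fun i => ¬ p i) (fun i => ¬ p i) := by
    ext a b
    have h := congr_fun (congr_fun hG a) b
    simpa [Matrix.toBlock, Matrix.transpose_apply, Matrix.map_apply] using h
  have hdet12 : G.det = (G.toBlock p p).det * (G.toBlock (fun i => ¬ p i) (fun i => ¬ p i)).det := by
    rw [Matrix.twoBlockTriangular_det G p (fun i hi j hj => hoff i j (by tauto))]
    rfl
  have hdet₁ : IsUnit (G.toBlock p p).det := by
    rw [hdet12] at hdet; exact isUnit_of_mul_isUnit_left hdet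
  have hdet₂ : IsUnit (G.toBlock (fun i => ¬ p i) (fun i => ¬ p i)).det := by
    rw [hdet12] at hdet; exact isUnit_of_mul_isUnit_right hdet
  obtain ⟨T₁, hT₁⟩ := HermitianUnimodular.exists_formCongr_eq_one σ hσ htr hnorm _ hG₁ hdet₁
  obtain ⟨T₂, hT₂⟩ := HermitianUnimodular.exists_formCongr_eq_one σ hσ htr hnorm _ hG₂ hdet₂
  change ((T₁ : Matrix _ _ 𝒪).map σ)ᵀ * G.toBlock p p * (T₁ : Matrix _ _ 𝒪) = 1 at hT₁
  change ((T₂ : Matrix _ _ 𝒪).map σ)ᵀ * G.toBlock (fun i => ¬ p i) (fun i => ¬ p i) * (T₂ : Matrix _ _ 𝒪) = 1 at hT₂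
  -- reassemble along `φ : {p} ⊕ {¬p} ≃ ι`
  set φ := Equiv.sumCompl p with hφ
  set T' : Matrix ({a // p a} ⊕ {a // ¬ p a}) ({a // p a} ⊕ {a // ¬ p a}) 𝒪 :=
    Matrix.fromBlocks (T₁ : Matrix _ _ 𝒪) 0 0 (T₂ : Matrix _ _ 𝒪) with hT'
  have hGφ : G.submatrix φ φ = Matrix.fromBlocks (G.toBlock p p) 0 0 (G.toBlock (fun i => ¬ p i) (fun i => ¬ p i)) := by
    ext (a | a) (b | b)
    · simp [φ, Matrix.toBlock]
    · simpa [φ, Matrix.toBlock] using hoff a.1 b.1 (by simp [a.2, b.2])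
    · simpa [φ, Matrix.toBlock] using hoff a.1 b.1 (by simp [a.2, b.2])
    · simp [φ, Matrix.toBlock]
  refine ⟨T'.submatrix φ.symm φ.symm, ?_, ?_, ?_⟩
  rotate_left
  · -- `ᵗ(σT) G T = 1`, checked after reindexing by `φ`
    have hTφ : (T'.submatrix φ.symm φ.symm).submatrix φ φ = T' := by
      rw [Matrix.submatrix_submatrix]; simp
    have key : (((T'.submatrix ⇑φ.symm ⇑φ.symm).map σ)ᵀ * G * T'.submatrix φ.symm φ.symm).submatrix φ φ = 1 := by
      rw [← Matrix.submatrix_mul_equiv _ _ _ φ _, ← Matrix.submatrix_mul_equiv _ _ _ φ _, hTφ, hGφ,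
        ← Matrix.transpose_submatrix, Matrix.submatrix_map, hTφ, hT', Matrix.fromBlocks_map, Matrix.fromBlocks_transpose,
        Matrix.fromBlocks_multiply, Matrix.fromBlocks_multiply]
      simp [hT₁, hT₂, Matrix.map_zero σ (map_zero σ)]
    have := congrArg (fun M : Matrix _ _ 𝒪 => M.submatrix φ.symm φ.symm) key
    simpa [Matrix.submatrix_submatrix, Matrix.submatrix_one_equiv] using this
  · intro i j hij
    by_cases hi : p i
    · have hj : ¬ p j := fun hj => hij (by simp [hi, hj])
      simp [T', φ, Equiv.sumCompl_symm_apply_of_pos hi, Equiv.sumCompl_symm_apply_of_neg hj]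
    · have hj : p j := by by_contra hj; exact hij (by simp [hi, hj])
      simp [T', φ, Equiv.sumCompl_symm_apply_of_neg hi, Equiv.sumCompl_symm_apply_of_pos hj]
  · rw [Matrix.det_submatrix_equiv_self, hT', Matrix.det_fromBlocks_zero₂₁]
    exact (Matrix.isUnits_det_units T₁).mul (Matrix.isUnits_det_units T₂)

end Block

/-! ## §2 Self-adjoint idempotents over a local ring: the adapted orthonormal frame -/

section Frame

variable {𝒪 : Type*} [CommRing 𝒪] [IsLocalRing 𝒪] (σ : 𝒪 →+* 𝒪) {m : ℕ}

/-- **ADAPTED ORTHONORMAL FRAME of a self-adjoint idempotent.**  `𝒪` local with involution `σ` satisfying (trace) and (norm),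
`J ∈ M_m(𝒪)` `σ`-hermitian with `det J ∈ 𝒪ˣ`, `e ∈ M_m(𝒪)` an idempotent which is SELF-ADJOINT for `J` (`τ e = e`,
`τ X = J⁻¹ ᵗ(σX) J`).  Then there is `B ∈ GL_m(𝒪)` which is `J`-ORTHONORMAL, `ᵗ(σB) J B = 1`, and ADAPTED to `e`:
`e B = B · diag(1,…,1,0,…,0)` with `r = rank_𝒪 (range e)` ones — i.e. `𝒪^m = e𝒪^m ⊥ (1 − e)𝒪^m` is an orthogonal splitting into
FREE unimodular summands, each with an orthonormal basis.  (Range and kernel of `e` are complementary direct summands of `𝒪^m`, hence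
finite projective, hence free over the local ring `𝒪`; they are `J`-orthogonal because `τ e = e`; the Gram matrix of an adapted basis
is unimodular and block-diagonal, and ★ Jacobowitz `HermitianUnimodular.exists_formCongr_eq_one` orthonormalises each block.)
[cite: Jacobowitz1962, §7 Thm. 7.1] [cite: Kottwitz1986, §7 Prop. 7.1] -/
theorem exists_formUnitary_frame_of_isIdempotentElem (hσ : ∀ x, σ (σ x) = x) (htr : ∃ b : 𝒪, b + σ b = 1)
    (hnorm : ∀ u : 𝒪, IsUnit u → σ u = u → ∃ t : 𝒪, t * σ t = u)
    {J : Matrix (Fin m) (Fin m) 𝒪} (hJ : (J.map σ)ᵀ = J) (hJdet : IsUnit J.det)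
    {e : Matrix (Fin m) (Fin m) 𝒪} (he : e * e = e) (hτe : J⁻¹ * (e.map σ)ᵀ * J = e) :
    ∃ B : Matrix (Fin m) (Fin m) 𝒪, IsUnit B.det ∧ (B.map σ)ᵀ * J * B = 1 ∧
      e * B = B * Matrix.diagonal
        (fun i : Fin m => if (i : ℕ) < Module.finrank 𝒪 (LinearMap.range (Matrix.toLin' e)) then (1 : 𝒪) else 0) := by
  classical
  -- self-adjointness as `ᵗ(σe) J = J e`
  have heJ : (e.map σ)ᵀ * J = J * e := by
    have h := congrArg (fun X => J * X) hτe
    simpa only [← Matrix.mul_assoc, Matrix.mul_nonsing_inv J hJdet, Matrix.one_mul] using h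
  have hσσ : ∀ M : Matrix (Fin m) (Fin m) 𝒪, (M.map σ).map σ = M := fun M => by ext i j; simp [hσ]
  -- the idempotent endomorphism and its range ∕ kernel
  set f : (Fin m → 𝒪) →ₗ[𝒪] (Fin m → 𝒪) := Matrix.toLin' e with hf_def
  have hff : f ∘ₗ f = f := by rw [hf_def, ← Matrix.toLin'_mul, he]
  have hf : IsIdempotentElem f := by
    change f * f = f
    rw [Module.End.mul_eq_comp]; exact hff
  set P : Submodule 𝒪 (Fin m → 𝒪) := LinearMap.range f with hP_def
  set Q : Submodule 𝒪 (Fin m → 𝒪) := LinearMap.ker f with hQ_def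
  have hPQ : IsCompl P Q := LinearMap.IsIdempotentElem.isCompl hf
  have hfP : ∀ x ∈ P, f x = x := by
    rintro x ⟨y, rfl⟩
    change (f ∘ₗ f) y = f y
    rw [hff]
  have hfQ : ∀ x ∈ Q, f x = 0 := fun x hx => hx
  -- `P`, `Q` are finite projective, hence free over the local ring `𝒪`
  have hQmem : ∀ x : Fin m → 𝒪, ((LinearMap.id : (Fin m → 𝒪) →ₗ[𝒪] (Fin m → 𝒪)) - f) x ∈ Q := by
    intro x
    change f (x - f x) = 0
    rw [map_sub]
    change f x - (f ∘ₗ f) x = 0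
    rw [hff, sub_self]
  set g : (Fin m → 𝒪) →ₗ[𝒪] Q :=
    LinearMap.codRestrict Q ((LinearMap.id : (Fin m → 𝒪) →ₗ[𝒪] (Fin m → 𝒪)) - f) hQmem with hg_def
  have hgQ : ∀ x : Q, g x = x := by
    rintro ⟨x, hx⟩
    apply Subtype.ext
    change x - f x = x
    rw [hfQ x hx, sub_zero]
  have hg : Function.Surjective g := fun x => ⟨x, hgQ x⟩
  haveI : Module.Finite 𝒪 P := Module.Finite.of_surjective f.rangeRestrict f.surjective_rangeRestrict
  haveI : Module.Finite 𝒪 Q := Module.Finite.of_surjective g hg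
  haveI : Module.Projective 𝒪 P :=
    Module.Projective.of_split P.subtype f.rangeRestrict (by
      ext x : 1
      apply Subtype.ext
      change f x = x
      exact hfP x x.2)
  haveI : Module.Projective 𝒪 Q := Module.Projective.of_split Q.subtype g (by ext x : 1; exact hgQ x)
  haveI : Module.Flat 𝒪 P := Module.Flat.of_projective
  haveI : Module.Flat 𝒪 Q := Module.Flat.of_projective
  haveI : Module.Free 𝒪 P := Module.free_of_flat_of_isLocalRing
  haveI : Module.Free 𝒪 Q := Module.free_of_flat_of_isLocalRing
  -- adapted basis of `𝒪^m`, indexed by `Fin r ⊕ Fin s`, then by `Fin m`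
  set r : ℕ := Module.finrank 𝒪 P with hr_def
  set s : ℕ := Module.finrank 𝒪 Q with hs_def
  set bP := Module.finBasis 𝒪 P with hbP_def
  set bQ := Module.finBasis 𝒪 Q with hbQ_def
  set bPQ : Module.Basis (Fin r ⊕ Fin s) 𝒪 (Fin m → 𝒪) := (bP.prod bQ).map (Submodule.prodEquivOfIsCompl P Q hPQ)
    with hbPQ_def
  have hbPQ_inl : ∀ a, bPQ (Sum.inl a) = (bP a : Fin m → 𝒪) := fun a => by simp [hbPQ_def]
  have hbPQ_inr : ∀ c, bPQ (Sum.inr c) = (bQ c : Fin m → 𝒪) := fun c => by simp [hbPQ_def]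
  have hrs : r + s = m := by
    have h := Fintype.card_congr (bPQ.indexEquiv (Pi.basisFun 𝒪 (Fin m)))
    simpa only [Fintype.card_sum, Fintype.card_fin] using h
  set ε : Fin r ⊕ Fin s ≃ Fin m := finSumFinEquiv.trans (finCongr hrs) with hε_def
  have hε1 : ∀ a : Fin r, ((ε (Sum.inl a) : Fin m) : ℕ) = a := fun a => by simp [hε_def]
  have hε2 : ∀ c : Fin s, ((ε (Sum.inr c) : Fin m) : ℕ) = r + c := fun c => by simp [hε_def]
  set bM : Module.Basis (Fin m) 𝒪 (Fin m → 𝒪) := bPQ.reindex ε with hbM_def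
  -- its column matrix
  set B₁ : Matrix (Fin m) (Fin m) 𝒪 := Matrix.of fun i j => bM j i with hB₁_def
  have hB₁eq : B₁ = (Pi.basisFun 𝒪 (Fin m)).toMatrix bM := by
    ext i j; simp [hB₁_def, Module.Basis.toMatrix_apply, Pi.basisFun_repr]
  have hB₁det : IsUnit B₁.det := by
    rw [hB₁eq]
    letI := (Pi.basisFun 𝒪 (Fin m)).invertibleToMatrix bM
    exact Matrix.isUnit_det_of_invertible _
  -- the 0∕1 diagonal
  set d : Fin m → 𝒪 := fun i => if (i : ℕ) < r then (1 : 𝒪) else 0 with hd_def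
  have hcol : ∀ j, e *ᵥ (bM j) = d j • bM j := by
    intro j
    obtain ⟨x, rfl⟩ := ε.surjective j
    have hbMx : bM (ε x) = bPQ x := by simp [hbM_def, Module.Basis.reindex_apply]
    rcases x with a | c
    · have hmem : bPQ (Sum.inl a) ∈ P := by rw [hbPQ_inl]; exact (bP a).2
      have h1 : d (ε (Sum.inl a)) = 1 := by simp only [hd_def, hε1, Fin.is_lt, if_true]
      rw [hbMx, h1, one_smul, ← Matrix.toLin'_apply]
      exact hfP _ hmem
    · have hmem : bPQ (Sum.inr c) ∈ Q := by rw [hbPQ_inr]; exact (bQ c).2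
      have h0 : d (ε (Sum.inr c)) = 0 := by simp [hd_def, hε2]
      rw [hbMx, h0, zero_smul, ← Matrix.toLin'_apply]
      exact hfQ _ hmem
  have heB₁ : e * B₁ = B₁ * Matrix.diagonal d := by
    ext i j
    have h := congr_fun (hcol j) i
    simp only [Matrix.mulVec, dotProduct, Pi.smul_apply, smul_eq_mul] at h
    rw [Matrix.mul_diagonal, Matrix.mul_apply]
    simpa only [hB₁_def, Matrix.of_apply, mul_comm (d j)] using h
  -- the Gram matrix of the frame: hermitian, unimodular, commuting with the 0∕1 diagonal
  set G : Matrix (Fin m) (Fin m) 𝒪 := (B₁.map σ)ᵀ * J * B₁ with hG_def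
  have hGh : (G.map σ)ᵀ = G := by
    rw [hG_def, Matrix.map_mul, Matrix.map_mul, Matrix.transpose_mul, Matrix.transpose_mul, ← Matrix.transpose_map, hσσ,
      Matrix.transpose_transpose, hJ, Matrix.mul_assoc]
  have hGdet : IsUnit G.det := by
    rw [hG_def, Matrix.det_mul, Matrix.det_mul, Matrix.det_transpose, ← RingHom.mapMatrix_apply, ← RingHom.map_det]
    exact ((hB₁det.map σ).mul hJdet).mul hB₁det
  have hdσ : (Matrix.diagonal d).map σ = Matrix.diagonal d := by
    rw [Matrix.diagonal_map (map_zero σ)]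
    congr 1; funext i
    by_cases hi : (i : ℕ) < r <;> simp [hd_def, hi]
  have hGD : G * Matrix.diagonal d = Matrix.diagonal d * G := by
    calc G * Matrix.diagonal d = (B₁.map σ)ᵀ * J * (B₁ * Matrix.diagonal d) := by rw [hG_def, Matrix.mul_assoc]
      _ = (B₁.map σ)ᵀ * J * (e * B₁) := by rw [heB₁]
      _ = (B₁.map σ)ᵀ * ((e.map σ)ᵀ * J) * B₁ := by rw [heJ]; simp only [Matrix.mul_assoc]
      _ = ((e * B₁).map σ)ᵀ * J * B₁ := by rw [Matrix.map_mul, Matrix.transpose_mul]; simp only [Matrix.mul_assoc]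
      _ = ((B₁ * Matrix.diagonal d).map σ)ᵀ * J * B₁ := by rw [heB₁]
      _ = Matrix.diagonal d * G := by
        rw [Matrix.map_mul, Matrix.transpose_mul, hdσ, Matrix.diagonal_transpose, hG_def]; simp only [Matrix.mul_assoc]
  have hoff : ∀ i j : Fin m, ¬ ((i : ℕ) < r ↔ (j : ℕ) < r) → G i j = 0 := by
    intro i j hij
    have h := congr_fun (congr_fun hGD i) j
    rw [Matrix.mul_diagonal, Matrix.diagonal_mul] at h
    by_cases hi : (i : ℕ) < r
    · have hj : ¬ (j : ℕ) < r := fun hj => hij ⟨fun _ => hj, fun _ => hi⟩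
      simpa [hd_def, hi, hj] using h.symm
    · have hj : (j : ℕ) < r := by
        by_contra hj; exact hij ⟨fun h => absurd h hi, fun h => absurd h hj⟩
      simpa [hd_def, hi, hj] using h
  obtain ⟨T, hTdet, hT1, hToff⟩ :=
    exists_congr_one_of_offBlock_eq_zero σ hσ htr hnorm (fun i : Fin m => (i : ℕ) < r) G hGh hGdet hoff
  have hTD : T * Matrix.diagonal d = Matrix.diagonal d * T := by
    ext i j
    rw [Matrix.mul_diagonal, Matrix.diagonal_mul]
    by_cases hi : (i : ℕ) < r <;> by_cases hj : (j : ℕ) < r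
    · simp [hd_def, hi, hj]
    · simp [hd_def, hi, hj, hToff i j (by simp [hi, hj])]
    · simp [hd_def, hi, hj, hToff i j (by simp [hi, hj])]
    · simp [hd_def, hi, hj]
  refine ⟨B₁ * T, ?_, ?_, ?_⟩
  · rw [Matrix.det_mul]; exact hB₁det.mul hTdet
  · calc ((B₁ * T).map σ)ᵀ * J * (B₁ * T) = (T.map σ)ᵀ * ((B₁.map σ)ᵀ * J * B₁) * T := by
          rw [Matrix.map_mul, Matrix.transpose_mul]; simp only [Matrix.mul_assoc]
      _ = 1 := by rw [← hG_def, hT1]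
  · calc e * (B₁ * T) = B₁ * Matrix.diagonal d * T := by rw [← Matrix.mul_assoc, heB₁]
      _ = B₁ * T * Matrix.diagonal d := by rw [Matrix.mul_assoc, ← hTD, ← Matrix.mul_assoc]

end Frame

/-! ## §3 Norm surjectivity on the commutant of a self-adjoint idempotent -/

section HNorm

variable {𝒪 : Type*} [CommRing 𝒪] [IsLocalRing 𝒪] (σ : 𝒪 →+* 𝒪) {m : ℕ}

/-- **`hnorm` FOR A SELF-ADJOINT IDEMPOTENT** — the hypothesis of ★ `exists_integral_unitary_conj_of_conj` at `γ := e`: over a local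
ring with involution satisfying (trace) and (norm), for `J` `σ`-hermitian unimodular and `e` an idempotent with `τ e = e`, every
`τ`-fixed invertible `b` COMMUTING with `e` is a norm `τ(c) c` of some `c` commuting with `e` (`τ X = J⁻¹ ᵗ(σX) J`).  Proof: `J b` is
again hermitian unimodular with `e` self-adjoint; if `B`, `B′` are the adapted orthonormal frames of `e` for `J` and for `J b`
(`exists_formUnitary_frame_of_isIdempotentElem` — the SAME `0∕1` diagonal on the right), then `c := B B′⁻¹` commutes with `e` and
`ᵗ(σc) J c = ᵗ(σB′⁻¹) B′⁻¹ = J b`.  This is the non-commutative («singular») counterpart of ★ `IntegralUnitaryConjugacyComplete.hnorm_of_isAdicComplete`.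
[cite: Kottwitz1986, §7 Prop. 7.1] [cite: Jacobowitz1962, §7 Thm. 7.1] -/
theorem exists_commute_hermAdjoint_mul_eq_of_isIdempotentElem (hσ : ∀ x, σ (σ x) = x) (htr : ∃ b : 𝒪, b + σ b = 1)
    (hnorm : ∀ u : 𝒪, IsUnit u → σ u = u → ∃ t : 𝒪, t * σ t = u)
    {J : Matrix (Fin m) (Fin m) 𝒪} (hJ : (J.map σ)ᵀ = J) (hJdet : IsUnit J.det)
    {e : Matrix (Fin m) (Fin m) 𝒪} (he : e * e = e) (hτe : J⁻¹ * (e.map σ)ᵀ * J = e) :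
    ∀ b : Matrix (Fin m) (Fin m) 𝒪, Commute e b → IsUnit b.det → J⁻¹ * (b.map σ)ᵀ * J = b →
      ∃ c : Matrix (Fin m) (Fin m) 𝒪, Commute e c ∧ J⁻¹ * (c.map σ)ᵀ * J * c = b := by
  intro b heb hb hτb
  -- `J b` is hermitian unimodular and `e` is self-adjoint for it
  have hbJ : (b.map σ)ᵀ * J = J * b := by
    have h := congrArg (fun X => J * X) hτb
    simpa only [← Matrix.mul_assoc, Matrix.mul_nonsing_inv J hJdet, Matrix.one_mul] using h
  have hJ' : ((J * b).map σ)ᵀ = J * b := by rw [Matrix.map_mul, Matrix.transpose_mul, hJ, hbJ]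
  have hJ'det : IsUnit (J * b).det := by rw [Matrix.det_mul]; exact hJdet.mul hb
  have hτe' : (J * b)⁻¹ * (e.map σ)ᵀ * (J * b) = e := by
    rw [Matrix.mul_inv_rev]
    calc b⁻¹ * J⁻¹ * (e.map σ)ᵀ * (J * b) = b⁻¹ * (J⁻¹ * (e.map σ)ᵀ * J) * b := by simp only [Matrix.mul_assoc]
      _ = b⁻¹ * (b * e) := by rw [hτe, Matrix.mul_assoc, heb.eq]
      _ = e := Matrix.nonsing_inv_mul_cancel_left b e hb
  obtain ⟨B, hBdet, hB1, heB⟩ := exists_formUnitary_frame_of_isIdempotentElem σ hσ htr hnorm hJ hJdet he hτe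
  obtain ⟨B', hB'det, hB'1, heB'⟩ := exists_formUnitary_frame_of_isIdempotentElem σ hσ htr hnorm hJ' hJ'det he hτe'
  set D : Matrix (Fin m) (Fin m) 𝒪 := Matrix.diagonal
    (fun i : Fin m => if (i : ℕ) < Module.finrank 𝒪 (LinearMap.range (Matrix.toLin' e)) then (1 : 𝒪) else 0) with hD
  have hX'det : IsUnit ((B'.map σ)ᵀ).det := by
    rw [Matrix.det_transpose, ← RingHom.mapMatrix_apply, ← RingHom.map_det]; exact hB'det.map σ
  -- `J b = ᵗ(σB′⁻¹) B′⁻¹`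
  have hJb : J * b = (B'⁻¹.map σ)ᵀ * B'⁻¹ := by
    rw [sigmaTranspose_nonsing_inv σ hB'det]
    calc J * b = ((B'.map σ)ᵀ)⁻¹ * ((B'.map σ)ᵀ * (J * b) * B') * B'⁻¹ := by
          rw [Matrix.mul_assoc ((B'.map σ)ᵀ), Matrix.nonsing_inv_mul_cancel_left _ _ hX'det,
            Matrix.mul_nonsing_inv_cancel_right B' _ hB'det]
      _ = ((B'.map σ)ᵀ)⁻¹ * B'⁻¹ := by rw [hB'1, Matrix.mul_one]
  refine ⟨B * B'⁻¹, ?_, ?_⟩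
  · -- `e` commutes with `B B′⁻¹`: both frames carry the same diagonal `D`
    have h1 : D * B'⁻¹ = B'⁻¹ * e := by
      calc D * B'⁻¹ = B'⁻¹ * (B' * D) * B'⁻¹ := by
            rw [← Matrix.mul_assoc, Matrix.nonsing_inv_mul B' hB'det, Matrix.one_mul]
        _ = B'⁻¹ * (e * B') * B'⁻¹ := by rw [heB']
        _ = B'⁻¹ * e := by rw [Matrix.mul_assoc, Matrix.mul_nonsing_inv_cancel_right B' _ hB'det]
    change e * (B * B'⁻¹) = B * B'⁻¹ * e
    rw [← Matrix.mul_assoc, heB, Matrix.mul_assoc, h1, Matrix.mul_assoc]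
  · calc J⁻¹ * ((B * B'⁻¹).map σ)ᵀ * J * (B * B'⁻¹)
          = J⁻¹ * ((B'⁻¹.map σ)ᵀ * ((B.map σ)ᵀ * J * B) * B'⁻¹) := by
            rw [Matrix.map_mul, Matrix.transpose_mul]; simp only [Matrix.mul_assoc]
      _ = b := by rw [hB1, Matrix.mul_one, ← hJb, Matrix.nonsing_inv_mul_cancel_left J b hJdet]

end HNorm

end Literature.LinearAlgebra.Matrix
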